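import Mathlib.NumberTheory.Padics.RingHoms
import Literature.NumberTheory.EllipticCurves.TwoDescentLocalGeneral
import Literature.NumberTheory.EllipticCurves.TwoDescentLocalTwo
import HarnessLib

/-!
# Local data of the complete `2`-descent, natively over `ℚ_p`

`TwoDescentLocalOdd.lean` / `TwoDescentLocalTwo.lean` attach to a RATIONAL number its `p`-adic
square-class data (parity of `v_p`, quadratic-residue bit of the unit part, and for `p = 2` the
residue of the odd part modulo `8` with the characters `chi4`, `chi8`). For the `2`-descents over
number fields `K ≠ ℚ` of the rank computation `rk E(F₄) = 6` (`E = 480a1`;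
T. Dokchitser–V. Dokchitser, *A note on the Mordell–Weil rank modulo n*, J. Number Theory 131
(2011), proof of Thm. 2) the points have coordinates in `K`, seen in `ℚ_p` through the embeddings
`K →+* ℚ_p` at the split places, so the same data is needed for arbitrary elements of `ℚ_p`.
This file provides it (namespace `Literature.NumberTheory.EllipticCurves.TwoDescentLocal`):

* `bitHom`: a `ℤ/2`-valued function on a field `F`, additive on products of non-zero elements,
  as a character `Additive (Fˣ/Fˣ²) →+ ℤ/2` (the common pattern behind the tree's `signHom`,
  `parityHom`, `qrHom`, `chi4Hom`, `chi8Hom`); `OddPlace.parityHom`, `OddPlace.χHom`;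
* for `t ∈ ℚ_p`: the unit part `punit p t = t · p^{-v(t)}` (`punitInt`, in `ℤ_p`), its residues
  `pres p t ∈ 𝔽_p`, `presPow p n t ∈ ℤ/pⁿ`, multiplicative and ultrametric
  (`presPow (t + s) = presPow t + p^k presPow s` if `v(s) = v(t) + k`, `k ≥ 1`), the residue bit
  `pχ p t` and **the `p`-adic place as an abstract odd place** `padicPlace p : OddPlace ℚ_[p]`
  (so that `OddPlace.local_conditions_of_mult` applies to `ℚ_p`-points and, by `OddPlace.comap`,
  to `K`-points);
* for `p = 2`: `pres8`, `pc4`, `pc8` (through the tree's `chi4Of`, `chi8Of`), additive on products;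
* compatibility with the rational data: `punit (q : ℚ_p) = unitPart p q`, `pres = res`,
  `presPow = resPow`, `pχ = qrBit`, `pc4 = chi4`, `pc8 = chi8` on rationals, so that the tree's
  value tables apply to rational constants.

Everything is proved (definitions + theorems, no named facts).

## References

* J. H. Silverman, *The Arithmetic of Elliptic Curves*, 2nd ed., GTM 106 (2009), X.1
  (Prop. X.1.4, Example X.1.5: `ℚ_p*/ℚ_p*²`). [SilvermanAEC2009]
* T. Dokchitser, V. Dokchitser, *A note on the Mordell–Weil rank modulo n*, J. Number Theory 131
  (2011) 1833–1839, proof of Thm. 2. [DokchitserDokchitser2011RankModN]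
-/

noncomputable section

open scoped Classical

open WeierstrassCurve.Affine

namespace Literature.NumberTheory.EllipticCurves.TwoDescentLocal

open Literature.NumberTheory.EllipticCurves.KramerTwoDescent

/-! ### Characters of `Fˣ/Fˣ²` from bits -/

section BitHom

variable {F : Type*} [Field F] (f : F → ZMod 2)
  (hf : ∀ {a b : F}, a ≠ 0 → b ≠ 0 → f (a * b) = f a + f b)

include hf in
/-- A bit additive on products vanishes at `1`. [folklore] -/
theorem bit_one : f 1 = 0 := by
  have h := hf (one_ne_zero (α := F)) one_ne_zero
  rw [mul_one] at h
  have : f 1 + f 1 = 0 := CharTwo.add_self_eq_zero _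
  rwa [← h] at this

/-- A bit additive on products of non-zero elements, as a homomorphism `Fˣ → ℤ/2`. [folklore] -/
def bitUnitsHom : Fˣ →* Multiplicative (ZMod 2) where
  toFun u := Multiplicative.ofAdd (f (u : F))
  map_one' := by rw [Units.val_one, bit_one f hf]; rfl
  map_mul' u v := by rw [Units.val_mul, hf u.ne_zero v.ne_zero, ofAdd_add]

/-- Squares lie in the kernel of `bitUnitsHom`. [folklore] -/
theorem range_powMonoidHom_le_ker_bitUnitsHom :
    (powMonoidHom 2 : Fˣ →* Fˣ).range ≤ (bitUnitsHom f hf).ker := by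
  rintro _ ⟨u, rfl⟩
  rw [MonoidHom.mem_ker]
  show Multiplicative.ofAdd (f ((u ^ 2 : Fˣ) : F)) = 1
  rw [Units.val_pow_eq_pow_val, sq, hf u.ne_zero u.ne_zero, CharTwo.add_self_eq_zero]
  rfl

/-- **The character of `Fˣ/Fˣ²` defined by a bit additive on products.** [folklore] -/
def bitHom : Additive (SqUnits F) →+ ZMod 2 :=
  MonoidHom.toAdditiveLeft
    (QuotientGroup.lift _ (bitUnitsHom f hf) (range_powMonoidHom_le_ker_bitUnitsHom f hf))

/-- The value of `bitHom` on a square class. [folklore] -/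
theorem bitHom_sqClass {a : F} (ha : a ≠ 0) :
    bitHom f hf (Additive.ofMul (sqClass a)) = f a := by
  rw [sqClass_of_ne_zero ha, bitHom, MonoidHom.toAdditiveLeft]
  simp [bitUnitsHom]

end BitHom

namespace OddPlace

variable {F : Type*} [Field F] (𝔳 : OddPlace F)

/-- The parity character `Fˣ/Fˣ² → ℤ/2` of an odd place. [folklore] -/
def parityHom : Additive (SqUnits F) →+ ZMod 2 :=
  bitHom 𝔳.parity (fun ha hb => 𝔳.parity_mul ha hb)

/-- The residue character `Fˣ/Fˣ² → ℤ/2` of an odd place. [folklore] -/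
def χHom : Additive (SqUnits F) →+ ZMod 2 :=
  bitHom 𝔳.χ (fun ha hb => 𝔳.χ_mul ha hb)

/-- Value of the parity character on a class. [folklore] -/
theorem parityHom_sqClass {a : F} (ha : a ≠ 0) :
    𝔳.parityHom (Additive.ofMul (sqClass a)) = 𝔳.parity a :=
  bitHom_sqClass _ _ ha

/-- Value of the residue character on a class. [folklore] -/
theorem χHom_sqClass {a : F} (ha : a ≠ 0) :
    𝔳.χHom (Additive.ofMul (sqClass a)) = 𝔳.χ a :=
  bitHom_sqClass _ _ ha

end OddPlace

/-! ### Valuations in `ℚ_p`: ultrametric lemmas -/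

section Padic

variable (p : ℕ) [hp : Fact p.Prime]

/-- `v(-t) = v(t)` in `ℚ_p`. [folklore] -/
theorem valuation_neg' (t : ℚ_[p]) : (-t).valuation = t.valuation := by
  by_cases ht : t = 0
  · rw [ht, neg_zero]
  · have h1 : (-1 : ℚ_[p]) ≠ 0 := neg_ne_zero.mpr one_ne_zero
    have hv1 : (-1 : ℚ_[p]).valuation = 0 := by
      rw [show (-1 : ℚ_[p]) = ((-1 : ℚ) : ℚ_[p]) by push_cast; rfl, Padic.valuation_ratCast,
        padicValRat.neg, padicValRat.one]
    rw [← neg_one_mul, Padic.valuation_mul h1 ht, hv1, zero_add]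

/-- The ultrametric inequality for `Padic.valuation` (non-zero elements). [folklore] -/
theorem min_le_valuation_add {t s : ℚ_[p]} (ht : t ≠ 0) (hs : s ≠ 0) (hts : t + s ≠ 0) :
    min t.valuation s.valuation ≤ (t + s).valuation := by
  have h := Padic.addValuation.map_add t s
  rw [Padic.addValuation.apply ht, Padic.addValuation.apply hs, Padic.addValuation.apply hts,
    ← WithTop.coe_min, WithTop.coe_le_coe] at h
  exact h

/-- Ultrametric domination for `Padic.valuation`: if `v(t) < v(s)` then `t + s ≠ 0` and
`v(t + s) = v(t)`. [folklore] -/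
theorem valuation_add_eq_left_of_lt {t s : ℚ_[p]} (ht : t ≠ 0) (hs : s ≠ 0)
    (hlt : t.valuation < s.valuation) : t + s ≠ 0 ∧ (t + s).valuation = t.valuation := by
  have hts : t + s ≠ 0 := by
    intro h0
    have : s = -t := by linear_combination h0
    rw [this, valuation_neg'] at hlt
    exact lt_irrefl _ hlt
  refine ⟨hts, le_antisymm ?_ ?_⟩
  · by_contra hgt
    push Not at hgt
    have h2 := min_le_valuation_add p hts (neg_ne_zero.mpr hs)
      (by rw [add_neg_cancel_right]; exact ht)
    rw [add_neg_cancel_right, valuation_neg'] at h2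
    exact absurd h2 (not_le.mpr (lt_min hgt hlt))
  · have h1 := min_le_valuation_add p ht hs hts
    rwa [min_eq_left hlt.le] at h1

/-! ### Unit parts and residues in `ℚ_p` -/

/-- The unit part `t · p^{-v(t)}` of `t ∈ ℚ_p` (`0` for `t = 0`). [folklore] -/
def punit (t : ℚ_[p]) : ℚ_[p] := t * (p : ℚ_[p]) ^ (-t.valuation)

/-- `punit 0 = 0`. [folklore] -/
theorem punit_zero : punit p 0 = 0 := by simp [punit]

/-- The unit part of `t ≠ 0` has norm `1`. [folklore] -/
theorem norm_punit {t : ℚ_[p]} (ht : t ≠ 0) : ‖punit p t‖ = 1 := by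
  have hp0 : (p : ℝ) ≠ 0 := Nat.cast_ne_zero.mpr hp.out.ne_zero
  rw [punit, norm_mul, Padic.norm_eq_zpow_neg_valuation ht, Padic.norm_p_zpow, neg_neg,
    ← zpow_add₀ hp0, neg_add_cancel, zpow_zero]

/-- The unit part is `p`-integral. [folklore] -/
theorem norm_punit_le_one (t : ℚ_[p]) : ‖punit p t‖ ≤ 1 := by
  by_cases ht : t = 0
  · rw [ht, punit_zero, norm_zero]; exact zero_le_one
  · exact (norm_punit p ht).le

/-- The unit part, as a `p`-adic integer. [folklore] -/
def punitInt (t : ℚ_[p]) : ℤ_[p] := ⟨punit p t, norm_punit_le_one p t⟩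

/-- `t = p^{v(t)} · punit t`. [folklore] -/
theorem zpow_mul_punit (t : ℚ_[p]) : (p : ℚ_[p]) ^ t.valuation * punit p t = t := by
  have hp0 : (p : ℚ_[p]) ≠ 0 := Nat.cast_ne_zero.mpr hp.out.ne_zero
  rw [punit, mul_comm, mul_assoc, ← zpow_add₀ hp0, neg_add_cancel, zpow_zero, mul_one]

/-- The unit part is multiplicative. [folklore] -/
theorem punit_mul {t s : ℚ_[p]} (ht : t ≠ 0) (hs : s ≠ 0) :
    punit p (t * s) = punit p t * punit p s := by
  have hp0 : (p : ℚ_[p]) ≠ 0 := Nat.cast_ne_zero.mpr hp.out.ne_zero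
  rw [punit, punit, punit, Padic.valuation_mul ht hs, neg_add, zpow_add₀ hp0]; ring

/-- The unit part of a unit is itself. [folklore] -/
theorem punit_of_valuation_eq_zero {t : ℚ_[p]} (h : t.valuation = 0) : punit p t = t := by
  rw [punit, h, neg_zero, zpow_zero, mul_one]

/-- `punit 1 = 1`. [folklore] -/
theorem punit_one : punit p 1 = 1 := punit_of_valuation_eq_zero p Padic.valuation_one

/-- `punitInt` is multiplicative. [folklore] -/
theorem punitInt_mul {t s : ℚ_[p]} (ht : t ≠ 0) (hs : s ≠ 0) :
    punitInt p (t * s) = punitInt p t * punitInt p s := by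
  apply PadicInt.ext
  simp [punitInt, punit_mul p ht hs, PadicInt.coe_mul]

/-- `punitInt 1 = 1`. [folklore] -/
theorem punitInt_one : punitInt p 1 = 1 := by
  apply PadicInt.ext; simp [punitInt, punit_one]

/-- `punitInt 0 = 0`. [folklore] -/
theorem punitInt_zero : punitInt p 0 = 0 := by
  apply PadicInt.ext; simp [punitInt, punit_zero]

/-- The unit part of `t ≠ 0` is a unit of `ℤ_p`. [folklore] -/
theorem isUnit_punitInt {t : ℚ_[p]} (ht : t ≠ 0) : IsUnit (punitInt p t) := by
  rw [PadicInt.isUnit_iff]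
  exact norm_punit p ht

/-- **Ultrametric unit parts**: if `v(s) = v(t) + k` (`t ≠ 0`) then
`punit (t + s) = punit t + p^k · punit s` in `ℤ_p`. [folklore] -/
theorem punitInt_add_of_eq {t s : ℚ_[p]} (ht : t ≠ 0) {k : ℕ} (hk : 1 ≤ k)
    (h : s.valuation = t.valuation + k) :
    punitInt p (t + s) = punitInt p t + (p : ℤ_[p]) ^ k * punitInt p s := by
  have hp0 : (p : ℚ_[p]) ≠ 0 := Nat.cast_ne_zero.mpr hp.out.ne_zero
  by_cases hs : s = 0
  · subst hs
    rw [add_zero, punitInt_zero, mul_zero, add_zero]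
  obtain ⟨-, hv⟩ := valuation_add_eq_left_of_lt p ht hs (by rw [h]; omega)
  have hpk : (p : ℚ_[p]) ^ k ≠ 0 := pow_ne_zero _ hp0
  apply PadicInt.ext
  rw [PadicInt.coe_add, PadicInt.coe_mul, PadicInt.coe_pow, PadicInt.coe_natCast]
  change punit p (t + s) = punit p t + (p : ℚ_[p]) ^ k * punit p s
  have e1 : (p : ℚ_[p]) ^ (-(t.valuation + (k : ℤ))) =
      (p : ℚ_[p]) ^ (-t.valuation) * ((p : ℚ_[p]) ^ k)⁻¹ := by
    rw [neg_add, zpow_add₀ hp0]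
    congr 1
    rw [zpow_neg, zpow_natCast]
  rw [punit, punit, punit, hv, h, e1]
  field_simp

/-- The residue in `𝔽_p` of the unit part of `t ∈ ℚ_p` (`0 ↦ 0`). [folklore] -/
def pres (t : ℚ_[p]) : ZMod p := PadicInt.toZMod (punitInt p t)

/-- The residue modulo `pⁿ` of the unit part of `t ∈ ℚ_p` (`0 ↦ 0`). [folklore] -/
def presPow (n : ℕ) (t : ℚ_[p]) : ZMod (p ^ n) := PadicInt.toZModPow n (punitInt p t)

/-- `pres` is multiplicative (non-zero arguments). [folklore] -/
theorem pres_mul {t s : ℚ_[p]} (ht : t ≠ 0) (hs : s ≠ 0) : pres p (t * s) = pres p t * pres p s := by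
  rw [pres, pres, pres, punitInt_mul p ht hs, map_mul]

/-- `presPow` is multiplicative (non-zero arguments). [folklore] -/
theorem presPow_mul (n : ℕ) {t s : ℚ_[p]} (ht : t ≠ 0) (hs : s ≠ 0) :
    presPow p n (t * s) = presPow p n t * presPow p n s := by
  rw [presPow, presPow, presPow, punitInt_mul p ht hs, map_mul]

/-- The residue of `t ≠ 0` is non-zero. [folklore] -/
theorem pres_ne_zero {t : ℚ_[p]} (ht : t ≠ 0) : pres p t ≠ 0 := by
  rw [pres, Ne, ← RingHom.mem_ker, PadicInt.ker_toZMod, IsLocalRing.mem_maximalIdeal, mem_nonunits_iff,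
    not_not]
  exact isUnit_punitInt p ht

/-- `presPow n t` is a unit for `t ≠ 0`. [folklore] -/
theorem isUnit_presPow (n : ℕ) {t : ℚ_[p]} (ht : t ≠ 0) : IsUnit (presPow p n t) :=
  (isUnit_punitInt p ht).map _

/-- **Ultrametric residues** modulo `pⁿ`: if `v(s) = v(t) + k`, `k ≥ 1`, `t ≠ 0`, then
`presPow (t + s) = presPow t + p^k presPow s`. [folklore] -/
theorem presPow_add_of_eq (n : ℕ) {t s : ℚ_[p]} (ht : t ≠ 0) {k : ℕ} (hk : 1 ≤ k)
    (h : s.valuation = t.valuation + k) :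
    presPow p n (t + s) = presPow p n t + (p : ZMod (p ^ n)) ^ k * presPow p n s := by
  rw [presPow, punitInt_add_of_eq p ht hk h, map_add, map_mul, map_pow, map_natCast]; rfl

/-- **Ultrametric residues** in `𝔽_p`: if `v(t) < v(s)` (or `s = 0`) then `pres (t + s) = pres t`.
[folklore] -/
theorem pres_add_of_lt {t s : ℚ_[p]} (ht : t ≠ 0) (h : s = 0 ∨ t.valuation < s.valuation) :
    pres p (t + s) = pres p t := by
  rcases h with rfl | hlt
  · rw [add_zero]
  by_cases hs : s = 0
  · rw [hs, add_zero]
  have hk : s.valuation = t.valuation + ((s.valuation - t.valuation).toNat : ℕ) := by omega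
  rw [pres, pres, punitInt_add_of_eq p ht (k := (s.valuation - t.valuation).toNat) (by omega) hk,
    map_add, map_mul, map_pow, map_natCast, ZMod.natCast_self, zero_pow (by omega), zero_mul,
    add_zero]

/-- The residue of `1` is `1`. [folklore] -/
theorem pres_one : pres p 1 = 1 := by rw [pres, punitInt_one, map_one]

/-- `presPow n 1 = 1`. [folklore] -/
theorem presPow_one (n : ℕ) : presPow p n 1 = 1 := by rw [presPow, punitInt_one, map_one]

/-- The residue only depends on the unit part: `pres (p^k t) = pres t`. [folklore] -/
theorem punit_zpow_mul (k : ℤ) {t : ℚ_[p]} (ht : t ≠ 0) :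
    punit p ((p : ℚ_[p]) ^ k * t) = punit p t := by
  have hp0 : (p : ℚ_[p]) ≠ 0 := Nat.cast_ne_zero.mpr hp.out.ne_zero
  rw [punit, punit, Padic.valuation_mul (zpow_ne_zero _ hp0) ht, Padic.valuation_zpow,
    Padic.valuation_p, mul_one, neg_add, zpow_add₀ hp0, zpow_neg]
  field_simp

/-- `presPow n (p^k t) = presPow n t`. [folklore] -/
theorem presPow_zpow_mul (n : ℕ) (k : ℤ) {t : ℚ_[p]} (ht : t ≠ 0) :
    presPow p n ((p : ℚ_[p]) ^ k * t) = presPow p n t := by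
  have : punitInt p ((p : ℚ_[p]) ^ k * t) = punitInt p t := by
    apply PadicInt.ext; simp [punitInt, punit_zpow_mul p k ht]
  rw [presPow, presPow, this]

/-- `pres (p^k t) = pres t`. [folklore] -/
theorem pres_zpow_mul (k : ℤ) {t : ℚ_[p]} (ht : t ≠ 0) :
    pres p ((p : ℚ_[p]) ^ k * t) = pres p t := by
  have : punitInt p ((p : ℚ_[p]) ^ k * t) = punitInt p t := by
    apply PadicInt.ext; simp [punitInt, punit_zpow_mul p k ht]
  rw [pres, pres, this]

/-! ### The residue bit and the `p`-adic place -/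

/-- `pχ p t = 1` iff the residue of the unit part of `t` is a non-square in `𝔽_p` (`0 ↦ 0`).
[folklore] -/
def pχ (t : ℚ_[p]) : ZMod 2 := if quadraticChar (ZMod p) (pres p t) = -1 then 1 else 0

/-- `pχ` vanishes iff the residue is a square. [folklore] -/
theorem pχ_eq_zero_iff (t : ℚ_[p]) : pχ p t = 0 ↔ IsSquare (pres p t) := by
  rw [pχ]
  constructor
  · intro h
    by_contra hns
    rw [if_pos ((quadraticChar_neg_one_iff_not_isSquare).mpr hns)] at h
    exact one_ne_zero h
  · intro hsq
    rw [if_neg]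
    rw [quadraticChar_neg_one_iff_not_isSquare, not_not]
    exact hsq

/-- **`pχ` is additive on products.** [folklore] -/
theorem pχ_mul {t s : ℚ_[p]} (ht : t ≠ 0) (hs : s ≠ 0) : pχ p (t * s) = pχ p t + pχ p s := by
  have hra := pres_ne_zero p ht
  have hrb := pres_ne_zero p hs
  simp only [pχ, pres_mul p ht hs, map_mul]
  rcases quadraticChar_dichotomy hra with h1 | h1
  · rcases quadraticChar_dichotomy hrb with h2 | h2
    · simp [h1, h2]
    · simp [h1, h2]
  · rcases quadraticChar_dichotomy hrb with h2 | h2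
    · simp [h1, h2]
    · simp only [h1, h2, mul_neg, mul_one, neg_neg, if_true]
      decide

/-- `pχ` only depends on the residue. [folklore] -/
theorem pχ_congr {t s : ℚ_[p]} (h : pres p t = pres p s) : pχ p t = pχ p s := by
  rw [pχ, pχ, h]

/-- **The `p`-adic place as an abstract odd place** (`v = Padic.valuation`, `χ = pχ`).
[folklore] -/
def padicPlace : OddPlace ℚ_[p] where
  v := Padic.valuation
  χ := pχ p
  v_mul' ht hs := Padic.valuation_mul ht hs
  min_le_v_add' ht hs hts := min_le_valuation_add p ht hs hts
  χ_mul' ht hs := pχ_mul p ht hs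
  χ_add_of_lt' ht _ hlt := pχ_congr p (pres_add_of_lt p ht (Or.inr hlt))

/-- The valuation of the `p`-adic place. [folklore] -/
@[simp] theorem padicPlace_v (t : ℚ_[p]) : (padicPlace p).v t = t.valuation := rfl

/-- The residue bit of the `p`-adic place. [folklore] -/
@[simp] theorem padicPlace_χ (t : ℚ_[p]) : (padicPlace p).χ t = pχ p t := rfl

/-- The parity bit of the `p`-adic place. [folklore] -/
theorem padicPlace_parity (t : ℚ_[p]) : (padicPlace p).parity t = (t.valuation : ZMod 2) := rfl

/-! ### Compatibility with the rational data -/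

/-- The unit part of a rational, computed in `ℚ_p`, is the tree's `unitPart`. [folklore] -/
theorem punit_ratCast (q : ℚ) : punit p (q : ℚ_[p]) = ((unitPart p q : ℚ) : ℚ_[p]) := by
  rw [punit, unitPart, Padic.valuation_ratCast, Rat.cast_div, Rat.cast_zpow, Rat.cast_natCast,
    div_eq_mul_inv, ← zpow_neg]

/-- `punitInt` of a rational is the tree's `unitPartInt`. [folklore] -/
theorem punitInt_ratCast (q : ℚ) : punitInt p (q : ℚ_[p]) = unitPartInt p q := by
  apply PadicInt.ext
  simp [punitInt, unitPartInt, punit_ratCast]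

/-- `presPow` of a rational is the tree's `resPow`. [folklore] -/
theorem presPow_ratCast (n : ℕ) (q : ℚ) : presPow p n (q : ℚ_[p]) = resPow p n q := by
  rw [presPow, punitInt_ratCast]; rfl

/-- A `p`-integral rational in `ℤ_p` reduces mod `p` to its cast in `𝔽_p`. [folklore] -/
theorem toZMod_ratCast {r : ℚ} (h : ‖(r : ℚ_[p])‖ ≤ 1) (hv : padicValRat p r = 0 ∨ ¬ p ∣ r.den) :
    PadicInt.toZMod (⟨(r : ℚ_[p]), h⟩ : ℤ_[p]) = (r : ZMod p) := by
  have hden : ¬ p ∣ r.den := by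
    rcases hv with hv | hv
    · exact not_dvd_den_of_padicValRat_eq_zero hv
    · exact hv
  set R : ℤ_[p] := ⟨(r : ℚ_[p]), h⟩ with hR
  have hI : R * (r.den : ℤ_[p]) = (r.num : ℤ_[p]) := by
    apply PadicInt.ext
    rw [PadicInt.coe_mul, PadicInt.coe_natCast, PadicInt.coe_intCast]
    change (r : ℚ_[p]) * (r.den : ℚ_[p]) = (r.num : ℚ_[p])
    rw [← Rat.cast_natCast, ← Rat.cast_intCast, ← Rat.cast_mul, Rat.mul_den_eq_num]
  have h1 := congrArg PadicInt.toZMod hI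
  rw [map_mul, map_natCast, map_intCast] at h1
  have hden' : (r.den : ZMod p) ≠ 0 := by
    rw [Ne, ZMod.natCast_eq_zero_iff]; exact hden
  have h2 : (r : ZMod p) * (r.den : ZMod p) = (r.num : ZMod p) := by
    rw [Rat.cast_def, div_mul_cancel₀ _ hden']
  exact mul_right_cancel₀ hden' (h1.trans h2.symm)

/-- `pres` of a rational is the tree's `res`. [folklore] -/
theorem pres_ratCast (q : ℚ) : pres p (q : ℚ_[p]) = res p q := by
  rw [pres, punitInt_ratCast, res]
  by_cases hq : q = 0
  · subst hq
    have h0 : unitPartInt p 0 = 0 := by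
      apply PadicInt.ext; simp [unitPartInt, unitPart, PadicInt.coe_zero]
    rw [h0, map_zero, unitPart, zero_div, Rat.cast_zero]
  · exact toZMod_ratCast p (norm_unitPart_le_one p q) (Or.inl (padicValRat_unitPart p hq))

/-- `pχ` of a rational is the tree's `qrBit`. [folklore] -/
theorem pχ_ratCast (q : ℚ) : pχ p (q : ℚ_[p]) = qrBit p q := by
  rw [pχ, qrBit, pres_ratCast]

/-- The valuation of the `p`-adic place on a rational. [folklore] -/
theorem padicPlace_v_ratCast (q : ℚ) : (padicPlace p).v (q : ℚ_[p]) = padicValRat p q :=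
  Padic.valuation_ratCast q

/-- The parity bit of the `p`-adic place on a rational. [folklore] -/
theorem padicPlace_parity_ratCast (q : ℚ) : (padicPlace p).parity (q : ℚ_[p]) = parityBit p q := by
  rw [padicPlace_parity, Padic.valuation_ratCast, parityBit]

/-- The residue bit of the `p`-adic place on a rational. [folklore] -/
theorem padicPlace_χ_ratCast (q : ℚ) : (padicPlace p).χ (q : ℚ_[p]) = qrBit p q :=
  pχ_ratCast p q

end Padic

/-! ### `p = 2`: residues modulo `8` and the characters `pc4`, `pc8` -/

section Two

/-- The residue modulo `8` of the odd part of `t ∈ ℚ₂`. [folklore] -/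
abbrev pres8 (t : ℚ_[2]) : ZMod (2 ^ 3) := presPow 2 3 t

/-- `pres8` is multiplicative. [folklore] -/
theorem pres8_mul {t s : ℚ_[2]} (ht : t ≠ 0) (hs : s ≠ 0) : pres8 (t * s) = pres8 t * pres8 s :=
  presPow_mul 2 3 ht hs

/-- The square of the residue mod `8` of an odd part is `1`. [folklore] -/
theorem pres8_mul_self {t : ℚ_[2]} (ht : t ≠ 0) : pres8 t * pres8 t = 1 := by
  have hu : IsUnit (pres8 t) := isUnit_presPow 2 3 ht
  have key : ∀ r : ZMod (2 ^ 3), IsUnit r → r * r = 1 := by decide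
  exact key _ hu

/-- `pres8 (2^k t) = pres8 t`. [folklore] -/
theorem pres8_two_zpow_mul (k : ℤ) {t : ℚ_[2]} (ht : t ≠ 0) :
    pres8 ((2 : ℚ_[2]) ^ k * t) = pres8 t := by
  have := presPow_zpow_mul 2 3 k ht
  rwa [Nat.cast_ofNat] at this

/-- Ultrametric residues mod `8`: `pres8 (t + s) = pres8 t + 2^k pres8 s` if `v(s) = v(t) + k`,
`k ≥ 1`. [folklore] -/
theorem pres8_add_of_eq {t s : ℚ_[2]} (ht : t ≠ 0) {k : ℕ} (hk : 1 ≤ k)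
    (h : s.valuation = t.valuation + k) :
    pres8 (t + s) = pres8 t + (2 : ZMod (2 ^ 3)) ^ k * pres8 s := by
  have := presPow_add_of_eq 2 3 ht hk h
  rwa [Nat.cast_ofNat] at this

/-- `pres8` of a rational is the tree's `res8`. [folklore] -/
theorem pres8_ratCast (q : ℚ) : pres8 (q : ℚ_[2]) = res8 q := presPow_ratCast 2 3 q

/-- `pc4 t = 1` iff the odd part of `t` is `≡ 3 (mod 4)`. [folklore] -/
def pc4 (t : ℚ_[2]) : ZMod 2 := chi4Of (pres8 t)

/-- `pc8 t = 1` iff the odd part of `t` is `≡ ±3 (mod 8)`. [folklore] -/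
def pc8 (t : ℚ_[2]) : ZMod 2 := chi8Of (pres8 t)

/-- `pc4` is additive on products. [folklore] -/
theorem pc4_mul {t s : ℚ_[2]} (ht : t ≠ 0) (hs : s ≠ 0) : pc4 (t * s) = pc4 t + pc4 s := by
  have key : ∀ r u : ZMod (2 ^ 3), r * r = 1 → u * u = 1 → chi4Of (r * u) = chi4Of r + chi4Of u := by
    decide
  rw [pc4, pc4, pc4, pres8_mul ht hs]
  exact key _ _ (pres8_mul_self ht) (pres8_mul_self hs)

/-- `pc8` is additive on products. [folklore] -/
theorem pc8_mul {t s : ℚ_[2]} (ht : t ≠ 0) (hs : s ≠ 0) : pc8 (t * s) = pc8 t + pc8 s := by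
  have key : ∀ r u : ZMod (2 ^ 3), r * r = 1 → u * u = 1 → chi8Of (r * u) = chi8Of r + chi8Of u := by
    decide
  rw [pc8, pc8, pc8, pres8_mul ht hs]
  exact key _ _ (pres8_mul_self ht) (pres8_mul_self hs)

/-- `pc4` of a rational is the tree's `chi4`. [folklore] -/
theorem pc4_ratCast (q : ℚ) : pc4 (q : ℚ_[2]) = chi4 q := by rw [pc4, pres8_ratCast, chi4]

/-- `pc8` of a rational is the tree's `chi8`. [folklore] -/
theorem pc8_ratCast (q : ℚ) : pc8 (q : ℚ_[2]) = chi8 q := by rw [pc8, pres8_ratCast, chi8]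

/-- The character `ℚ₂ˣ/ℚ₂ˣ² → ℤ/2` given by `pc4`. [folklore] -/
def pc4Hom : Additive (SqUnits ℚ_[2]) →+ ZMod 2 := bitHom pc4 (fun ht hs => pc4_mul ht hs)

/-- The character `ℚ₂ˣ/ℚ₂ˣ² → ℤ/2` given by `pc8`. [folklore] -/
def pc8Hom : Additive (SqUnits ℚ_[2]) →+ ZMod 2 := bitHom pc8 (fun ht hs => pc8_mul ht hs)

/-- Value of `pc4Hom` on a class. [folklore] -/
theorem pc4Hom_sqClass {t : ℚ_[2]} (ht : t ≠ 0) : pc4Hom (Additive.ofMul (sqClass t)) = pc4 t :=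
  bitHom_sqClass _ _ ht

/-- Value of `pc8Hom` on a class. [folklore] -/
theorem pc8Hom_sqClass {t : ℚ_[2]} (ht : t ≠ 0) : pc8Hom (Additive.ofMul (sqClass t)) = pc8 t :=
  bitHom_sqClass _ _ ht

/-- **Two `2`-adic units sum to a non-unit**: if `v(t) = v(s) = 0` and `t + s ≠ 0` then
`v(t + s) ≥ 1`. [folklore] -/
theorem one_le_valuation_add_of_units {t s : ℚ_[2]} (ht0 : t ≠ 0) (hs0 : s ≠ 0)
    (ht : t.valuation = 0) (hs : s.valuation = 0) (hts : t + s ≠ 0) :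
    1 ≤ (t + s).valuation := by
  by_contra hlt
  have hge : 0 ≤ (t + s).valuation := by
    have := min_le_valuation_add 2 ht0 hs0 hts
    rw [ht, hs, min_self] at this
    exact this
  have h0 : (t + s).valuation = 0 := by omega
  -- the three elements are `2`-adic integers equal to their unit parts
  have nt : ‖t‖ ≤ 1 := by
    rw [Padic.norm_eq_zpow_neg_valuation ht0, ht, neg_zero, zpow_zero]
  have ns : ‖s‖ ≤ 1 := by
    rw [Padic.norm_eq_zpow_neg_valuation hs0, hs, neg_zero, zpow_zero]
  set T : ℤ_[2] := ⟨t, nt⟩ with hT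
  set S : ℤ_[2] := ⟨s, ns⟩ with hS
  have hut : punitInt 2 t = T := by
    apply PadicInt.ext; change punit 2 t = t; exact punit_of_valuation_eq_zero 2 ht
  have hus : punitInt 2 s = S := by
    apply PadicInt.ext; change punit 2 s = s; exact punit_of_valuation_eq_zero 2 hs
  have huts : punitInt 2 (t + s) = T + S := by
    apply PadicInt.ext
    rw [PadicInt.coe_add]
    change punit 2 (t + s) = t + s
    exact punit_of_valuation_eq_zero 2 h0
  -- residues mod 2: `1 + 1 = 1` is absurd
  have key : ∀ r : ZMod 2, r ≠ 0 → r = 1 := by decide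
  have hra : PadicInt.toZMod T = 1 := by rw [← hut]; exact key _ (pres_ne_zero 2 ht0)
  have hrb : PadicInt.toZMod S = 1 := by rw [← hus]; exact key _ (pres_ne_zero 2 hs0)
  have hrab : PadicInt.toZMod (T + S) = 1 := by rw [← huts]; exact key _ (pres_ne_zero 2 hts)
  rw [map_add, hra, hrb] at hrab
  exact absurd hrab (by decide)

end Two

end Literature.NumberTheory.EllipticCurves.TwoDescentLocal

end
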